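import Literature.Computability.Cryptography.GoldreichLevin
import Literature.Computability.Complexity.AveragingCounting
import HarnessLib

/-!
# From a predictor of the Goldreich–Levin bit of `f^k` to a weak direct-product oracle

Trunk `CryptoQuantFine` / T-CPLX-CORE. Fifth instalment of the decomposition of the named fact
`Literature.Computability.Learning.cikk_natural_implies_learning` (CIKK 2016, Thm. 5.1), covering
CIKK Claim 4.4 (inside the proof of Thm. 4.3, case `AC⁰[2]`) in exact counting form: if a
(deterministic) predictor `C₂(x⃗, r)` agrees with `(f^k)^{GL}(x⃗, r) = ⟨f^k(x⃗), r⟩` on at least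
a `1/2 + γ` fraction of the pairs `(x⃗, r)`, then Rackoff's Goldreich–Levin candidate
`glCandidate (C₂(x⃗, ·)) kk s σ` for a uniformly random seed tuple `s` and a uniformly random
guess `σ` (CIKK: "output a uniformly random k-bit string from the list") computes `f^k(x⃗)`
exactly on at least an `η = γ/(4·2^kk)` fraction of the tuples `x⃗`, for at least an `η`
fraction of the choices `(s, σ)` (`card_goodSeedGuess_ge`), provided `k ≤ (γ²/2)(2^kk - 1)`.

Proof (CIKK): averaging over `x⃗` (`card_goodRows_ge`: a `≥ γ` fraction of the rows have
agreement `≥ 1/2 + γ/2`), Goldreich–Levin on each such row (`goldreich_levin_half` with `γ/2`: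
for half of the seeds the secret `f^k(x⃗)` is the candidate of the TRUE guess), and averaging
over `(s, σ)` (`card_rows_ge_of_density`). The list-size loss is `2^{-kk}` (one guess out of
`2^kk`) instead of CIKK's `Ω(γ²)`; only polynomial factors are at stake.

## References

* M. Carmosino, R. Impagliazzo, V. Kabanets, A. Kolokolova, *Learning algorithms from natural
  proofs*, CCC 2016, Claim 4.4 and Thm. 4.2 [CarmosinoImpagliazzoKabanetsKolokolova2016].
* S. Arora, B. Barak, *Computational Complexity: A Modern Approach*, CUP 2009, Thm. 9.12
  [AroraBarak2009].
-/

open Finset Matrix Literature.Computability.Complexity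

namespace Literature.Computability.Cryptography

variable {U : Type*} [Fintype U] {k : ℕ}

/-- The direct product `f^k(x⃗)` as a vector over `𝔽₂` (CIKK §4: "`g = f^k`", with bits read in
`GF(2)`). [cite: CarmosinoImpagliazzoKabanetsKolokolova2016, §4 (Direct Product)] -/
def dpVec (f : U → Bool) (xs : Fin k → U) : BVec k := fun i => if f (xs i) then 1 else 0

/-- The Goldreich–Levin bit of the direct product: `(f^k)^{GL}(x⃗, r) = ⟨f^k(x⃗), r⟩ over `𝔽₂`.
[cite: CarmosinoImpagliazzoKabanetsKolokolova2016, §4 (definition of `g^{GL}`)] -/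
def dpGL (f : U → Bool) (p : (Fin k → U) × BVec k) : ZMod 2 := dpVec f p.1 ⬝ᵥ p.2

/-- **CIKK Claim 4.4, counting form.** If `C₂` agrees with `⟨f^k(x⃗), r⟩` on at least a `1/2 + γ`
fraction of the pairs `(x⃗, r)` and `k ≤ (γ²/2)(2^kk - 1)`, then for at least an
`η = γ / (4 · 2^kk)` fraction of the pairs (seed tuple `s`, guess `σ`), Rackoff's candidate
`x⃗ ↦ glCandidate (C₂(x⃗, ·)) kk s σ` equals `f^k(x⃗)` on at least an `η` fraction of the tuples.
[cite: CarmosinoImpagliazzoKabanetsKolokolova2016, Claim 4.4] -/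
theorem card_goodSeedGuess_ge [Nonempty U] (f : U → Bool) {kk : ℕ} (hkk : 0 < kk)
    (C₂ : (Fin k → U) × BVec k → ZMod 2) {γ : ℝ} (hγ : 0 < γ)
    (hm : (k : ℝ) ≤ 2 * (γ / 2) ^ 2 * (2 ^ kk - 1 : ℕ))
    (h : (1 / 2 + γ) * (Fintype.card (Fin k → U) * Fintype.card (BVec k)) ≤
      ((univ.filter fun p : (Fin k → U) × BVec k => C₂ p = dpGL f p).card : ℝ)) :
    γ / (4 * 2 ^ kk) * Fintype.card ((Fin kk → BVec k) × (Fin kk → ZMod 2)) ≤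
      ((univ.filter fun q : (Fin kk → BVec k) × (Fin kk → ZMod 2) =>
        γ / (4 * 2 ^ kk) * Fintype.card (Fin k → U) ≤
          ((univ.filter fun xs : Fin k → U =>
            glCandidate (fun r => C₂ (xs, r)) kk q.1 q.2 = dpVec f xs).card : ℝ)).card : ℝ) := by
  classical
  -- the candidate computed from the seed tuple `q.1` and the guess `q.2`
  set cand : (Fin kk → BVec k) × (Fin kk → ZMod 2) → (Fin k → U) → BVec k := fun q xs =>
    glCandidate (fun r => C₂ (xs, r)) kk q.1 q.2 with hcand
  -- Step 1: many rows `x⃗` have agreement `≥ 1/2 + γ/2`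
  have hrows := card_goodRows_ge (A := Fin k → U) (B := BVec k)
    (fun xs r => C₂ (xs, r) = dpVec f xs ⬝ᵥ r) hγ.le (by exact h)
  set goodRows := univ.filter fun xs : Fin k → U =>
    (1 / 2 + γ / 2) * Fintype.card (BVec k) ≤
      ((univ.filter fun r : BVec k => C₂ (xs, r) = dpVec f xs ⬝ᵥ r).card : ℝ) with hgoodRows
  -- Step 2: on a good row, for half of the seeds the secret `f^k(x⃗)` is on the list, hence is
  -- the candidate of SOME guess
  have hGL : ∀ xs ∈ goodRows, (Fintype.card (Fin kk → BVec k) : ℝ) / 2 ≤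
      ((univ.filter fun q : (Fin kk → BVec k) × (Fin kk → ZMod 2) =>
        cand q xs = dpVec f xs).card : ℝ) := by
    intro xs hxs
    have hB := (mem_filter.1 hxs).2
    have hhalf := goldreich_levin_half kk (fun r => C₂ (xs, r)) (dpVec f xs) (γ := γ / 2)
      (by positivity) hB hkk hm
    refine hhalf.trans ?_
    -- inject the good seeds into the good (seed, guess) pairs
    have hlist : ∀ sd ∈ (univ.filter fun sd : Fin kk → BVec k =>
        dpVec f xs ∈ glList (fun r => C₂ (xs, r)) kk sd),
        ∃ σ : Fin kk → ZMod 2, cand (sd, σ) xs = dpVec f xs := by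
      intro sd hsd
      have hmem := (mem_filter.1 hsd).2
      rw [glList, mem_image] at hmem
      obtain ⟨σ, -, hσ⟩ := hmem
      exact ⟨σ, hσ⟩
    choose! pick hpick using hlist
    exact_mod_cast Finset.card_le_card_of_injOn (fun sd => (sd, pick sd))
      (fun sd hsd => by
        rw [mem_coe, mem_filter] at hsd ⊢
        exact ⟨mem_univ _, hpick sd (mem_filter.2 hsd)⟩)
      (fun sd _ sd' _ heq => (Prod.ext_iff.1 heq).1)
  -- Step 3: hence many good triples (seed, guess, row)
  have hGs : (Fintype.card (Fin kk → ZMod 2) : ℝ) = 2 ^ kk := by simp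
  have hSdGs : (Fintype.card ((Fin kk → BVec k) × (Fin kk → ZMod 2)) : ℝ) =
      Fintype.card (Fin kk → BVec k) * 2 ^ kk := by
    rw [Fintype.card_prod, Nat.cast_mul, hGs]
  have htriples : γ / (2 * 2 ^ kk) *
      (Fintype.card ((Fin kk → BVec k) × (Fin kk → ZMod 2)) * Fintype.card (Fin k → U)) ≤
      ((univ.filter fun t : ((Fin kk → BVec k) × (Fin kk → ZMod 2)) × (Fin k → U) =>
        cand t.1 t.2 = dpVec f t.2).card : ℝ) := by
    have hcount : ((univ.filter fun t : ((Fin kk → BVec k) × (Fin kk → ZMod 2)) × (Fin k → U) =>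
        cand t.1 t.2 = dpVec f t.2).card : ℝ) =
        ∑ xs : Fin k → U, ((univ.filter fun q : (Fin kk → BVec k) × (Fin kk → ZMod 2) =>
          cand q xs = dpVec f xs).card : ℝ) := by
      rw [natCast_card_filter, Fintype.sum_prod_type_right]
      exact Finset.sum_congr rfl fun xs _ => by rw [natCast_card_filter]
    rw [hcount, hSdGs]
    calc γ / (2 * 2 ^ kk) * (Fintype.card (Fin kk → BVec k) * 2 ^ kk * Fintype.card (Fin k → U))
        = (γ * Fintype.card (Fin k → U)) * ((Fintype.card (Fin kk → BVec k) : ℝ) / 2) := by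
          field_simp
      _ ≤ goodRows.card * ((Fintype.card (Fin kk → BVec k) : ℝ) / 2) :=
          mul_le_mul_of_nonneg_right hrows (by positivity)
      _ = ∑ _xs ∈ goodRows, (Fintype.card (Fin kk → BVec k) : ℝ) / 2 := by
          rw [Finset.sum_const, nsmul_eq_mul]
      _ ≤ ∑ xs ∈ goodRows, ((univ.filter fun q : (Fin kk → BVec k) × (Fin kk → ZMod 2) =>
            cand q xs = dpVec f xs).card : ℝ) := Finset.sum_le_sum hGL
      _ ≤ ∑ xs : Fin k → U, ((univ.filter fun q : (Fin kk → BVec k) × (Fin kk → ZMod 2) =>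
            cand q xs = dpVec f xs).card : ℝ) :=
          Finset.sum_le_sum_of_subset_of_nonneg (subset_univ _) fun _ _ _ => Nat.cast_nonneg _
  -- Step 4: averaging over (seed, guess)
  have hfinal := card_rows_ge_of_density (A := (Fin kk → BVec k) × (Fin kk → ZMod 2))
    (B := Fin k → U) (fun q xs => cand q xs = dpVec f xs) (ρ := γ / (2 * 2 ^ kk))
    (by positivity) htriples
  have hρ : γ / (2 * 2 ^ kk) / 2 = γ / (4 * 2 ^ kk) := by ring
  rw [hρ] at hfinal
  exact hfinal

end Literature.Computability.Cryptography
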